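import Literature.Probability.RandomPlanarGeometry.HexSAWRotSurfaceYcLimitAllY
import Literature.Probability.RandomPlanarGeometry.HexSAWArmchairSlabLocality
import Literature.Probability.RandomPlanarGeometry.HexSAWBrickWallSlabLocality
import Literature.Probability.RandomPlanarGeometry.HexSAWBrickWallSlabFugacityLocality
import Literature.Probability.RandomPlanarGeometry.HexSAWBrickWallSlabFugacityStrict
import Literature.Probability.RandomPlanarGeometry.HexSAWBrickWallSlabFugacityContinuous
import Literature.Probability.RandomPlanarGeometry.HexSAWArmchairWallRateSqrtMonotone
import Mathlib.Topology.UniformSpace.Dini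
import HarnessLib

/-!
# Beaton's strips of the rotated honeycomb lattice, Proposition 9 sentence 2 WITHOUT the wall-bridge lower bound:
# `μ_T(1,y) → μ(y)` for EVERY `y > 0`, `μ_T(1,y) < μ(y)` for every strip, `μ(y) = sup_T μ_T(1,y)`,
# and the convergence is LOCALLY UNIFORM in the fugacity on `(0, ∞)` (Dini)

Topic `Literature/Probability/RandomPlanarGeometry` (lane «pcv-sawmu», rotated-door lineage, a-p6 g14).  This module is the
door-free re-foundation of the lane's «STRIP-LOCALITY» statements: it imports only BUILT modules plus the slab-continuity module
`HexSAWBrickWallSlabFugacityContinuous.lean` (Proposition 8's continuity clause, `HexBW.continuousOn_slabMuY`), and it does NOT use the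
wall-bridge lower bound `μ ≤ β_rot(y)` of `HexSAWArmchairWallBridgeRate.lean` / `HexSAWRotSurfaceArmRate.lean`.  Inputs:
`HexSAWArmchairSlabLocality.lean` (`Arm.slabMuY_le_of_archBound : ArchBound y → μ_H(y,1) ≤ max (β_rot(y)) μ`),
`HexSAWArmchairUnfolding.lean` (`Arm.archBound_holds`, via `HexSAWRotSurfaceYcLimitAllY.lean`), `HexSAWArmchairSlabWallBridges.lean`
(`Arm.eventually_le_slabMuY : r < β_rot(y) → ∀ᶠ H, r ≤ μ_H(y,1)`), `HexSAWBrickWallSlabLocality.lean` (`tendsto_slabConnectiveConstant :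
μ_H → μ`, the `y = 1` locality), `HexSAWBrickWallSlabFugacityLocality.lean` (`slabConnectiveConstant_le_slabMuY_succ : μ_H ≤ μ_{H+1}(y,1)`
for every `y > 0` — the walks that leave the wall at once), `HexSAWBrickWallSlabFugacityStrict.lean` (`slabMuY_lt_succ`),
`HexSAWArmchairWallRateSqrtMonotone.lean` (`continuousOn_rotSurfaceMu`), and Mathlib's Dini theorem
`Monotone.tendstoLocallyUniformlyOn_of_forall_tendsto`.

Source.  N. R. Beaton, *The critical surface fugacity of self-avoiding walks on a rotated honeycomb lattice*, J. Phys. A 47 (2014)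
075003, arXiv:1210.0274v3, §3.2, Proposition 9 (p. 15): "For `y > 0`, `μ_T(1,y) < μ_{T+1}(1,y)`. Moreover, as `T → ∞`,
`μ_T(1,y) → μ(y)`, where `μ(y)` is as defined in Proposition 7."  Here `μ(y) = HV.rotSurfaceMu y = max (β_rot(y)) μ` (tree
`HexSAWRotSurfaceArmchairDictionary.lean`; `= β_rot(y)` for `y > y†`, tree `HV.rotSurfaceMu_eq_armRate`; `= μ` for `y ≤ y†`), and
Beaton's strip of height `T` is the column slab with `HexBW.slabMuY H y = μ_H(y,1)` (`= μ_H(1,y)` by Proposition 8's symmetry).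

## What is proved

* §1 (pointwise, every `y > 0`): `HV.slabMuY_le_rotSurfaceMu` (`μ_H(y,1) ≤ μ(y)`), ★ `HV.slabMuY_lt_rotSurfaceMu` (STRICT, every `H ≥ 1`),
  `HV.eventually_lt_slabMuY_of_lt_armRate`, `HV.eventually_lt_slabMuY_of_lt` (every `r < μ(y)` is eventually exceeded),
  ★★ **`HV.tendsto_slabMuY_rotSurfaceMu_of_pos`** (`μ_H(y,1) → μ(y)`, Proposition 9 sentence 2, for EVERY `y > 0`),
  `HV.rotSurfaceMu_eq_iSup_slabMuY` (`μ(y) = ⨆_H μ_{H+1}(y,1)`), and for `y > y†` the same limit written as `β_rot(y)` (`HV.tendsto_slabMuY_armRate`).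
* §2 (Dini on `(0, ∞)`): ★★ **`HV.tendstoLocallyUniformlyOn_slabMuY`** — `TendstoLocallyUniformlyOn (fun H y => μ_{H+1}(y,1)) μ atTop (Ioi 0)`;
  `HV.tendstoUniformlyOn_slabMuY_of_isCompact` (every compact `K ⊆ (0, ∞)`); `HV.eventually_forall_Icc_sub_lt_slabMuY` (the ε-form on
  fugacity windows `[a, b]`, `a > 0`: eventually `μ(y) − ε < μ_H(y,1) ≤ μ(y)` for all `y ∈ [a, b]` at once).

NAMING / OVERLAP.  The limit theorem is `HV.tendsto_slabMuY_rotSurfaceMu_of_pos`; the lane's banked one-car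
`HexSAWRotSurfaceArmRate.lean` (not landed: its parent `HexSAWArmchairWallBridgeRate.lean` has no olean) states the same limit as
`HV.tendsto_slabMuY_rotSurfaceMu` through `μ ≤ β_rot(y)`; when that car is filed it should drop its copy (this module makes it door-free).

HONEST LABEL.  §1's limit statement is Proposition 9 sentence 2 AS PRINTED, for every `y > 0`; the strict comparison with the limit,
the supremum formula and §2 are LANE COROLLARIES (Dini), not claimed to be in print.  Nothing here uses or proves `μ ≤ β_rot(y)`: below
`β_rot(y)` the strip rates are pushed up by the wall bridges confined to the strip (`eventually_le_slabMuY`), below `μ` by the walks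
that leave the wall at once (`μ_H ≤ μ_{H+1}(y,1)`, `μ_H → μ`), and `μ(y) = max (β_rot(y)) μ` is an upper bound by the arch bound.
-/

noncomputable section

open Filter Function Set
open Literature.Probability.LatticeModels Literature.Probability.Percolation
open _root_.Topology

namespace Literature.Probability.RandomPlanarGeometry.SAW.HV

open Literature.Probability.RandomPlanarGeometry.SAW.HexBW Literature.Probability.RandomPlanarGeometry.SAW.HexBW.Arm

variable {y : ℝ} {H : ℕ}

/-! ### §1 Pointwise strip locality -/

/-- **`μ_H(y,1) ≤ μ(y)`** for every strip `H ≥ 1` and every `y > 0` (the arch bound holds for every `y`, tree `archBound_holds`).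
[cite: Beaton2014RotatedHoneycomb, §3.2, Proposition 9 (arXiv:1210.0274v3 p. 15)] -/
theorem slabMuY_le_rotSurfaceMu (hy : 0 < y) (hH : 1 ≤ H) : slabMuY H y ≤ rotSurfaceMu y :=
  slabMuY_le_of_archBound hy (archBound_holds hy) hH

/-- ★ **`μ_H(y,1) < μ(y)` for EVERY strip** (`H ≥ 1`, `y > 0`): `μ_H < μ_{H+1} ≤ μ(y)`.
[cite: Beaton2014RotatedHoneycomb, §3.2, Proposition 9 (arXiv:1210.0274v3 p. 15: both sentences); lane corollary] -/
theorem slabMuY_lt_rotSurfaceMu (hy : 0 < y) (hH : 1 ≤ H) : slabMuY H y < rotSurfaceMu y :=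
  (slabMuY_lt_succ hH hy).trans_le (slabMuY_le_rotSurfaceMu hy (by omega))

/-- Every `r < β_rot(y)` is eventually exceeded STRICTLY by the strip rates (`y > 0`).
[cite: Beaton2014RotatedHoneycomb, §3.2, Proposition 9 (arXiv:1210.0274v3 p. 15)] -/
theorem eventually_lt_slabMuY_of_lt_armRate (hy : 0 < y) {r : ℝ} (hr : r < armRate y) :
    ∀ᶠ H : ℕ in atTop, r < slabMuY H y := by
  obtain ⟨r', hrr', hr'⟩ := exists_between hr
  filter_upwards [eventually_le_slabMuY hy hr'] with H hH using hrr'.trans_le hH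

/-- Every `r < μ(y)` is eventually exceeded by the strip rates (`y > 0`): below `β_rot(y)` by the wall bridges confined to the strip,
below `μ` through `μ_{H−1} ≤ μ_H(y,1)` (the walks that leave the wall at once) and `μ_H → μ` (the `y = 1` slab locality).
[cite: Beaton2014RotatedHoneycomb, §3.2, Proposition 9 (arXiv:1210.0274v3 p. 15) with Proposition 7 (p. 11: μ(y) ≥ max{μ, √y})] -/
theorem eventually_lt_slabMuY_of_lt (hy : 0 < y) {r : ℝ} (hr : r < rotSurfaceMu y) :
    ∀ᶠ H : ℕ in atTop, r < slabMuY H y := by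
  rcases lt_max_iff.1 (show r < max (armRate y) hexConnectiveConstant from hr) with h | h
  · exact eventually_lt_slabMuY_of_lt_armRate hy h
  · have h1 : ∀ᶠ H : ℕ in atTop, r < slabConnectiveConstant H := (tendsto_order.1 tendsto_slabConnectiveConstant).1 r h
    have h2 : ∀ᶠ H : ℕ in atTop, r < slabConnectiveConstant (H - 1) := (tendsto_sub_atTop_nat 1).eventually h1
    filter_upwards [h2, eventually_ge_atTop 2] with H hH hH2
    calc r < slabConnectiveConstant (H - 1) := hH
      _ ≤ slabMuY (H - 1 + 1) y := slabConnectiveConstant_le_slabMuY_succ (by omega) hy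
      _ = slabMuY H y := by rw [Nat.sub_add_cancel (by omega : 1 ≤ H)]

/-- ★★ **Beaton 2014, Proposition 9, second sentence: `μ_T(1,y) → μ(y)` as `T → ∞`**, for every `y > 0` — proved WITHOUT the wall-bridge
lower bound `μ ≤ β_rot(y)`. [cite: Beaton2014RotatedHoneycomb, §3.2, Proposition 9 (arXiv:1210.0274v3 p. 15: "as T → ∞, μ_T(1,y) → μ(y)")] -/
theorem tendsto_slabMuY_rotSurfaceMu_of_pos (hy : 0 < y) : Tendsto (fun H : ℕ => slabMuY H y) atTop (𝓝 (rotSurfaceMu y)) := by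
  rw [tendsto_order]
  refine ⟨fun r hr => eventually_lt_slabMuY_of_lt hy hr, fun r hr => ?_⟩
  filter_upwards [eventually_ge_atTop 1] with H hH using (slabMuY_le_rotSurfaceMu hy hH).trans_lt hr

/-- The strip rates are monotone in the strip index (index shifted so that every strip counts).
[cite: Beaton2014RotatedHoneycomb, §3.2, Proposition 9 (arXiv:1210.0274v3 p. 15: "μ_T(1,y) < μ_{T+1}(1,y)")] -/
theorem monotone_slabMuY_succ (hy : 0 < y) : Monotone (fun H : ℕ => slabMuY (H + 1) y) :=
  monotone_nat_of_le_succ fun H => (slabMuY_lt_succ (by omega : 1 ≤ H + 1) hy).le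

/-- `μ_{H+1}(y,1) → μ(y)` (index shifted), `y > 0`. [cite: Beaton2014RotatedHoneycomb, §3.2, Proposition 9 (arXiv:1210.0274v3 p. 15)] -/
theorem tendsto_slabMuY_succ_rotSurfaceMu (hy : 0 < y) :
    Tendsto (fun H : ℕ => slabMuY (H + 1) y) atTop (𝓝 (rotSurfaceMu y)) :=
  (tendsto_slabMuY_rotSurfaceMu_of_pos hy).comp (tendsto_add_atTop_nat 1)

/-- **`μ(y) = sup_H μ_{H+1}(y,1)`** for `y > 0`. [cite: Beaton2014RotatedHoneycomb, §3.2, Proposition 9 (arXiv:1210.0274v3 p. 15); lane corollary] -/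
theorem rotSurfaceMu_eq_iSup_slabMuY (hy : 0 < y) : rotSurfaceMu y = ⨆ H : ℕ, slabMuY (H + 1) y :=
  tendsto_nhds_unique (tendsto_slabMuY_succ_rotSurfaceMu hy)
    (tendsto_atTop_ciSup (monotone_slabMuY_succ hy) ⟨rotSurfaceMu y, by
      rintro _ ⟨H, rfl⟩; exact slabMuY_le_rotSurfaceMu hy (by omega)⟩)

/-- In the supercritical window the limit is the wall-bridge rate: `μ_H(y,1) → β_rot(y)` for `y > y†` (there `μ(y) = β_rot(y)`).
[cite: Beaton2014RotatedHoneycomb, §3.2, Proposition 9 with Theorem 1 (arXiv:1210.0274v3 pp. 2, 15)] -/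
theorem tendsto_slabMuY_armRate (h : rotYdagger < y) : Tendsto (fun H : ℕ => slabMuY H y) atTop (𝓝 (armRate y)) := by
  have hy0 : 0 < y := rotYdagger_pos.trans h
  rw [← rotSurfaceMu_eq_armRate hy0 h]
  exact tendsto_slabMuY_rotSurfaceMu_of_pos hy0

/-- Below the critical fugacity the limit is the bulk connective constant: `μ_H(y,1) → μ` for `0 < y ≤ y†` (there `μ(y) = μ`).
[cite: Beaton2014RotatedHoneycomb, §3.2, Proposition 9 with Proposition 7 and Theorem 1 (arXiv:1210.0274v3 pp. 2, 11, 15)] -/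
theorem tendsto_slabMuY_hexConnectiveConstant (hy : 0 < y) (h : y ≤ rotYdagger) :
    Tendsto (fun H : ℕ => slabMuY H y) atTop (𝓝 hexConnectiveConstant) := by
  have hlt : ¬ hexConnectiveConstant < armRate y := fun hlt =>
    not_le.2 ((hexConnectiveConstant_lt_armRate_iff hy).1 hlt) h
  have hmax : rotSurfaceMu y = hexConnectiveConstant := max_eq_right (not_lt.1 hlt)
  rw [← hmax]
  exact tendsto_slabMuY_rotSurfaceMu_of_pos hy

/-! ### §2 Dini: local uniformity in the fugacity on `(0, ∞)` -/

/-- ★★ **DINI: `μ_{H+1}(y,1) → μ(y)` LOCALLY UNIFORMLY in `y ∈ (0, ∞)`** (monotone in `H`; each `μ_{H+1}(·,1)` and the limit `μ(·)` continuous).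
[cite: Beaton2014RotatedHoneycomb, §3.2, Propositions 8–9 (arXiv:1210.0274v3 p. 15: continuity in y; monotone convergence in T); lane corollary via Dini's theorem] -/
theorem tendstoLocallyUniformlyOn_slabMuY :
    TendstoLocallyUniformlyOn (fun (H : ℕ) (y : ℝ) => slabMuY (H + 1) y) rotSurfaceMu atTop (Set.Ioi 0) :=
  Monotone.tendstoLocallyUniformlyOn_of_forall_tendsto (fun H => continuousOn_slabMuY (by omega : 1 ≤ H + 1))
    (fun _ hy _ _ hHH' => monotone_slabMuY_succ hy hHH') continuousOn_rotSurfaceMu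
    fun _ hy => tendsto_slabMuY_succ_rotSurfaceMu hy

/-- **Uniform convergence on every compact fugacity set `K ⊆ (0, ∞)`.**
[cite: Beaton2014RotatedHoneycomb, §3.2, Propositions 8–9 (arXiv:1210.0274v3 p. 15); lane corollary via Dini's theorem] -/
theorem tendstoUniformlyOn_slabMuY_of_isCompact {K : Set ℝ} (hK : IsCompact K) (hK0 : K ⊆ Set.Ioi 0) :
    TendstoUniformlyOn (fun (H : ℕ) (y : ℝ) => slabMuY (H + 1) y) rotSurfaceMu atTop K :=
  Monotone.tendstoUniformlyOn_of_forall_tendsto hK (fun H => (continuousOn_slabMuY (by omega : 1 ≤ H + 1)).mono hK0)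
    (fun _ hy _ _ hHH' => monotone_slabMuY_succ (hK0 hy) hHH') (continuousOn_rotSurfaceMu.mono hK0)
    fun _ hy => tendsto_slabMuY_succ_rotSurfaceMu (hK0 hy)

/-- **The ε-form on a fugacity window**: for `0 < a`, any `b` and `ε > 0`, for all large `H` and ALL `y ∈ [a, b]` at once,
`μ(y) − ε < μ_H(y,1) ≤ μ(y)`. [cite: Beaton2014RotatedHoneycomb, §3.2, Proposition 9 (arXiv:1210.0274v3 p. 15); lane corollary via Dini's theorem] -/
theorem eventually_forall_Icc_sub_lt_slabMuY {a b ε : ℝ} (ha : 0 < a) (hε : 0 < ε) :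
    ∀ᶠ H : ℕ in atTop, ∀ y ∈ Set.Icc a b, rotSurfaceMu y - ε < slabMuY H y ∧ slabMuY H y ≤ rotSurfaceMu y := by
  have hK0 : Set.Icc a b ⊆ Set.Ioi 0 := fun y hy => ha.trans_le hy.1
  have hU := tendstoUniformlyOn_slabMuY_of_isCompact isCompact_Icc hK0
  rw [Metric.tendstoUniformlyOn_iff] at hU
  have h1 := hU ε hε
  have h2 : ∀ᶠ H : ℕ in atTop, 1 ≤ H := eventually_ge_atTop 1
  filter_upwards [(tendsto_sub_atTop_nat 1).eventually h1, h2] with H hH hH1 y hy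
  have hH' : dist (rotSurfaceMu y) (slabMuY (H - 1 + 1) y) < ε := hH y hy
  rw [Nat.sub_add_cancel hH1, Real.dist_eq, abs_sub_lt_iff] at hH'
  exact ⟨by linarith [hH'.1], slabMuY_le_rotSurfaceMu (hK0 hy) hH1⟩

end Literature.Probability.RandomPlanarGeometry.SAW.HV

end
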